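import Summits.BirchSwinnertonDyer.BirchSwinnertonDyer.Theorems.KimAtThreeShallowEqDeepPortSeam
import HarnessLib

/-!
# Route `KimAtThreeKolyvagin` (W2): the Kato–Kurihara port at `3` as ONE ITEM TEXT in the route file's own
# vocabulary — off the Kato stratum (PORT@3-OFF) or on every row (PORT@3-ALL) — and the LEAF / crux 19077 /
# crux 19599 / crux 19560 / alias 19678 BY NAME from it

Cell `bsd-addord`, seat `bsd-addord-w2-c4` (gen 7, owner of 19599; item 19077).  `--supports` 19077.
HONEST FRAMING. TOOL theorems only (no definition, no named fact, no `sorry`); nothing asserted about any curve,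
nothing booked; 19599 / 19077 / 19562 / 19560 stay OPEN; BSD is not proved by any of this.  The displayed
hypotheses `hItem` (PORT@3-OFF) and `hAll` (PORT@3-ALL) are candidate FIRST-LAYER ITEM texts for the planner, spelled
so that they ELABORATE INSIDE THE ROUTE FILE `Theses/KimAtThreeKolyvagin.lean` (kernel-checked: seat file
`work/PortOffSigRoute.lean`, imports = the route file only): n1011's ONE-exponent witness clauses
`Summit.BirchSwinnertonDyer.Rank1Residual.GaloisImage.KatoKuriharaWitnessAt W₀ · 0 · v₃ P` at two depths + (COMP),
for all depths `k ≤ k′`, all `τ`-data canonical for the SAME generator family `η`, every pinned reduction — on every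
tower-surjective `W₀` with `E(ℚ₃)[3] = 0`, every `v₃ ∣ 3`, `η`, and every lattice-optimal datum `P` at the
conductor, OFF the Kato stratum (PORT@3-OFF) resp. everywhere (PORT@3-ALL).  This is crux 19560
`KatoKuriharaPortThreeShared`'s shape with the port UNLOCKED (no `3 ∤ c₃` / `3 ∤ c_P` / period-transfer
antecedent); FLAG `K22-Thm3.13-PORT@3`, NOT in print at `3`.  WHY the one-exponent currency suffices: the
two-exponent port with `∃ e` (PortSeam's `hPortOff`, acc6's `KatoKuriharaWitnessAtTwoExp`, value law
`3^e · Λ(loc κ_d) = u · δ̃`; `e = v₃(c₃) + v₃(c_P)` in print on additive-defect rows, `e = v₃(c₃)` at a split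
multiplicative `3`) and the `e = 0` port are INTER-DERIVABLE as hypotheses — Kato's families scaled by `3^e`
satisfy the one-exponent clauses (acc6's `katoKuriharaWitnessAt_smul_of_witnessAtTwoExp`), and conversely
`katoKuriharaWitnessAtTwoExp_zero_of_witnessAt`; the route file cannot import `KimAtThreeKolyvaginDefs` (which imports
the route file) but already imports `GaloisImage.KatoKuriharaPortThreeWith`.
* `portOff_of_portOffWitnessAt` — PORT@3-OFF item ⟹ PortSeam's `hPortOff` (take `e = 0`);
* the planner's would-be `closes (h19678 : KatoStratumSharedParts) (hOff : ITEM) : LEAF` is the ONE-LINE composition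
  `KimAtThreeShallowEqDeepPortSeam.kimAtThreeRankZeroPUB_of_sharedParts_of_portOff (portOff_of_portOffWitnessAt hOff) h19678`
  (likewise `shallowEqDeepAtTorsionFree_of_sharedParts_of_portOff (portOff_of_portOffWitnessAt hOff) h19678` for crux 19077 BY NAME;
  not restated here — the gate's dedup identifies them with the PortSeam theorems); `shallowEqDeepOffKatoStratum_of_sharedParts_of_portOffWitnessAt`
  (crux 19599 BY NAME ⟸ the PUB parts of 19678 ∧ ITEM);
* `katoKuriharaPortThreeShared_of_portAll` — **crux 19560 BY NAME ⟸ PORT@3-ALL** (PORT″ is the item LOCKED);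
  `katoStratumSharedParts_of_pub_of_portAll` — alias 19678 BY NAME ⟸ the four PUBLISHED leaves ∧ PORT@3-ALL;
* **`kimAtThreeRankZeroPUB_of_pub_of_portAll : SakamotoKolyvaginThree → RankEqAnalyticRankLeOne →
  PoitouTateSelmerDuality → CarayolLevelEqConductor → PORT@3-ALL → LEAF`** — W2 = PUB + ONE port item.
References: [Kim2022StructureSelmer] Thm. 3.13, Lemma 3.3, 3.8; [Kato2004Asterisque] Thm. 12.5 (1); [MazurRubin2004]
Thm. 3.2.4, App. A (33); [Kim2025RefinedTNC] Thm. 1.1, §4.2; [Sakamoto2024] Thm. 4.4; [Carayol1986].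
-/

set_option autoImplicit false
-- the Theorems namespace of a single-conjunct summit repeats the summit name by design (D-0017)
set_option linter.dupNamespace false

noncomputable section

namespace Summit.BirchSwinnertonDyer.BirchSwinnertonDyer.Theorems.KimAtThreeShallowEqDeepPortItem

open scoped Classical NumberField ContRepresentation
open Function IsDedekindDomain NumberField WeierstrassCurve CongruenceSubgroup
  Literature.NumberTheory.EllipticCurves Literature.NumberTheory.EllipticCurves.ModularForms
  Literature.NumberTheory.EllipticCurves.Rank1Residual
  Literature.NumberTheory.GaloisRepresentations
  Literature.NumberTheory.GaloisRepresentations.DiscreteGaloisModule Literature.NumberTheory.GaloisCohomology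
  Summit.BirchSwinnertonDyer.Rank1Residual.GaloisImage
  Summit.BirchSwinnertonDyer.Rank1Residual.Additive
  Summit.BirchSwinnertonDyer.BirchSwinnertonDyer.Theses.KimAtThreeKolyvagin
  Summit.BirchSwinnertonDyer.BirchSwinnertonDyer.Theorems
  Summit.BirchSwinnertonDyer.BirchSwinnertonDyer.Theorems.KimAtThreeKolyvaginDefs
  Summit.BirchSwinnertonDyer.BirchSwinnertonDyer.Theorems.KimAtThreeShallowEqDeepPortSeam

/-! ### §1 PORT@3-OFF as an item text -/

section Item

variable
  (hItem : ∀ (W₀ : WeierstrassCurve ℚ) [W₀.IsElliptic] [W₀.IsGloballyMinimal],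
      (∀ n : ℕ, W₀.HasSurjectiveModNGaloisRep (3 ^ n : ℕ)) →
      Nat.card {Q : (W₀.baseChange ℚ_[3]).toAffine.Point // (3 : ℕ) • Q = 0} = 1 →
      ∀ (v₃ : IsDedekindDomain.HeightOneSpectrum (NumberField.RingOfIntegers ℚ)),
        ((3 : ℕ) : NumberField.RingOfIntegers ℚ) ∈ v₃.asIdeal →
      ∀ (η : (q : IsDedekindDomain.HeightOneSpectrum (NumberField.RingOfIntegers ℚ)) →
          (ZMod (Ideal.absNorm q.asIdeal))ˣ), (∀ q, Subgroup.zpowers (η q) = ⊤) →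
      ∀ {N : ℕ} [NeZero N] (P : Literature.NumberTheory.EllipticCurves.ModularForms.ModularParametrizationData W₀ N),
        N = W₀.conductorNorm ℤ →
        (∀ z ∈ P.L.lattice, ∃ w ∈ Literature.NumberTheory.EllipticCurves.ModularForms.periodLattice P.f,
          z = P.c * w) →
        ¬ ((haveI : Fact (Nat.Prime 3) := ⟨Nat.prime_three⟩;
              Literature.NumberTheory.EllipticCurves.Rank1Residual.Addv W₀ 3) ∧
            ¬ 3 ∣ (W₀.baseChange ℚ_[3]).localTamagawaNumber ℤ_[3] ∧ ¬ (3 : ℤ) ∣ P.maninConstant) →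
        ∀ (k k' : ℕ)
          (Dk : Literature.NumberTheory.GaloisCohomology.KolyvaginDatum
            (W₀.torsionGaloisModule (((3 : ℕ) : ℤ) ^ k * ((3 : ℕ) : ℤ))))
          (Dk' : Literature.NumberTheory.GaloisCohomology.KolyvaginDatum
            (W₀.torsionGaloisModule (((3 : ℕ) : ℤ) ^ k' * ((3 : ℕ) : ℤ))))
          (red : ContIntertwiningMap (W₀.torsionGaloisModule (((3 : ℕ) : ℤ) ^ k' * ((3 : ℕ) : ℤ))).toContRepresentation
            (W₀.torsionGaloisModule (((3 : ℕ) : ℤ) ^ k * ((3 : ℕ) : ℤ))).toContRepresentation),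
          Dk.IsCanonicalTauDatumThreeAtWith W₀ k k η → Dk'.IsCanonicalTauDatumThreeAtWith W₀ k' k' η → k ≤ k' →
          (∀ x : W₀.geomTorsion (((3 : ℕ) : ℤ) ^ k' * ((3 : ℕ) : ℤ)),
            ((red x : W₀.geomTorsion (((3 : ℕ) : ℤ) ^ k * ((3 : ℕ) : ℤ))) : W₀.geomPoints) =
              (((3 : ℕ) : ℤ) ^ (k' - k)) • (x : W₀.geomPoints)) →
          ∃ κ Λ κ' κu Λu κu',
            Summit.BirchSwinnertonDyer.Rank1Residual.GaloisImage.KatoKuriharaWitnessAt W₀ k 0 Dk v₃ P κ Λ κ' ∧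
            Summit.BirchSwinnertonDyer.Rank1Residual.GaloisImage.KatoKuriharaWitnessAt W₀ k' 0 Dk' v₃ P κu Λu κu' ∧
            ∀ d, Dk'.IsLevel d → Dk.IsLevel d →
              Literature.NumberTheory.GaloisRepresentations.galoisCohomology.map red 1 (κu d) = κ d ∧
              Literature.NumberTheory.GaloisRepresentations.galoisCohomology.map red 1 (κu' d) = κ' d)

include hItem

/-- **PORT@3-OFF item text ⟹ PortSeam's `hPortOff`** (take `e = 0`; n1011's one-exponent witness clauses ARE the
two-exponent ones at `e = 0`: `KimAtThreeKolyvaginDefs.katoKuriharaWitnessAtTwoExp_zero_of_witnessAt`).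
[cite: Kim2022StructureSelmer, Thm. 3.13 (arXiv p. 17)] [cite: Kato2004Asterisque, Thm. 12.5 (1)] -/
theorem portOff_of_portOffWitnessAt :
    ∀ (W₀ : WeierstrassCurve ℚ) [W₀.IsElliptic] [W₀.IsGloballyMinimal],
      (∀ n : ℕ, W₀.HasSurjectiveModNGaloisRep (3 ^ n : ℕ)) →
      Nat.card {Q : (W₀.baseChange ℚ_[3]).toAffine.Point // (3 : ℕ) • Q = 0} = 1 →
      ∀ (v₃ : HeightOneSpectrum (𝓞 ℚ)), ((3 : ℕ) : 𝓞 ℚ) ∈ v₃.asIdeal →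
      ∀ (η : (q : HeightOneSpectrum (𝓞 ℚ)) → (ZMod (Ideal.absNorm q.asIdeal))ˣ),
        (∀ q, Subgroup.zpowers (η q) = ⊤) →
      ∀ {N : ℕ} [NeZero N] (P : ModularParametrizationData W₀ N), N = W₀.conductorNorm ℤ →
        (∀ z ∈ P.L.lattice, ∃ w ∈ periodLattice P.f, z = P.c * w) →
        ¬ ((haveI : Fact (Nat.Prime 3) := ⟨Nat.prime_three⟩; Addv W₀ 3) ∧
            ¬ 3 ∣ (W₀.baseChange ℚ_[3]).localTamagawaNumber ℤ_[3] ∧ ¬ (3 : ℤ) ∣ P.maninConstant) →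
        ∃ e : ℕ, ∀ (k k' : ℕ)
          (Dk : KolyvaginDatum (W₀.torsionGaloisModule (((3 : ℕ) : ℤ) ^ k * ((3 : ℕ) : ℤ))))
          (Dk' : KolyvaginDatum (W₀.torsionGaloisModule (((3 : ℕ) : ℤ) ^ k' * ((3 : ℕ) : ℤ))))
          (red : (W₀.torsionGaloisModule (((3 : ℕ) : ℤ) ^ k' * ((3 : ℕ) : ℤ))).toContRepresentation →ⁱL
            (W₀.torsionGaloisModule (((3 : ℕ) : ℤ) ^ k * ((3 : ℕ) : ℤ))).toContRepresentation),
          Dk.IsCanonicalTauDatumThreeAtWith W₀ k k η → Dk'.IsCanonicalTauDatumThreeAtWith W₀ k' k' η → k ≤ k' →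
          (∀ x : geomTorsion W₀ (((3 : ℕ) : ℤ) ^ k' * ((3 : ℕ) : ℤ)),
            ((red x : geomTorsion W₀ (((3 : ℕ) : ℤ) ^ k * ((3 : ℕ) : ℤ))) : geomPoints W₀) =
              (((3 : ℕ) : ℤ) ^ (k' - k)) • (x : geomPoints W₀)) →
          ∃ κ Λ κ' κu Λu κu',
            KatoKuriharaWitnessAtTwoExp W₀ k 0 e Dk v₃ P κ Λ κ' ∧
            KatoKuriharaWitnessAtTwoExp W₀ k' 0 e Dk' v₃ P κu Λu κu' ∧
            ∀ d, Dk'.IsLevel d → Dk.IsLevel d →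
              galoisCohomology.map red 1 (κu d) = κ d ∧ galoisCohomology.map red 1 (κu' d) = κ' d := by
  intro W₀ _ _ htow ht v₃ hv₃ η hη N _ P hN hopt hoff
  refine ⟨0, fun k k' Dk Dk' red hDk hDk' hk hred => ?_⟩
  obtain ⟨κ, Λ, κ', κu, Λu, κu', hW, hW', hcomp⟩ :=
    hItem W₀ htow ht v₃ hv₃ η hη P hN hopt hoff k k' Dk Dk' red hDk hDk' hk hred
  exact ⟨κ, Λ, κ', κu, Λu, κu', katoKuriharaWitnessAtTwoExp_zero_of_witnessAt hW,
    katoKuriharaWitnessAtTwoExp_zero_of_witnessAt hW', hcomp⟩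

/-- **Crux 19599 `ShallowEqDeepOffKatoStratum` BY NAME ⟸ the PUBLISHED parts of alias 19678 ∧ the PORT@3-OFF
item text** (PORT″ / Carayol are not used). [cite: Kim2025RefinedTNC, Thm. 1.1 and Thm. 1.2]
[cite: Sakamoto2024, Thm. 4.4 (p. 926)] [cite: MilneADT2006, Ch. I, Thm. 4.10] -/
theorem shallowEqDeepOffKatoStratum_of_sharedParts_of_portOffWitnessAt (hParts : KatoStratumSharedParts) :
    ShallowEqDeepOffKatoStratum := by
  obtain ⟨hSak, hGZK, hPT, -, -⟩ := hParts
  exact shallowEqDeepOffKatoStratum_of_portOff (portOff_of_portOffWitnessAt hItem) hSak.1 hSak.2 hGZK hPT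

end Item

/-! ### §2 PORT@3-ALL as an item text: crux 19560, alias 19678 and the LEAF by name -/

section All

variable
  (hAll : ∀ (W₀ : WeierstrassCurve ℚ) [W₀.IsElliptic] [W₀.IsGloballyMinimal],
      (∀ n : ℕ, W₀.HasSurjectiveModNGaloisRep (3 ^ n : ℕ)) →
      Nat.card {Q : (W₀.baseChange ℚ_[3]).toAffine.Point // (3 : ℕ) • Q = 0} = 1 →
      ∀ (v₃ : IsDedekindDomain.HeightOneSpectrum (NumberField.RingOfIntegers ℚ)),
        ((3 : ℕ) : NumberField.RingOfIntegers ℚ) ∈ v₃.asIdeal →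
      ∀ (η : (q : IsDedekindDomain.HeightOneSpectrum (NumberField.RingOfIntegers ℚ)) →
          (ZMod (Ideal.absNorm q.asIdeal))ˣ), (∀ q, Subgroup.zpowers (η q) = ⊤) →
      ∀ {N : ℕ} [NeZero N] (P : Literature.NumberTheory.EllipticCurves.ModularForms.ModularParametrizationData W₀ N),
        N = W₀.conductorNorm ℤ →
        (∀ z ∈ P.L.lattice, ∃ w ∈ Literature.NumberTheory.EllipticCurves.ModularForms.periodLattice P.f,
          z = P.c * w) →
        ∀ (k k' : ℕ)
          (Dk : Literature.NumberTheory.GaloisCohomology.KolyvaginDatum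
            (W₀.torsionGaloisModule (((3 : ℕ) : ℤ) ^ k * ((3 : ℕ) : ℤ))))
          (Dk' : Literature.NumberTheory.GaloisCohomology.KolyvaginDatum
            (W₀.torsionGaloisModule (((3 : ℕ) : ℤ) ^ k' * ((3 : ℕ) : ℤ))))
          (red : ContIntertwiningMap (W₀.torsionGaloisModule (((3 : ℕ) : ℤ) ^ k' * ((3 : ℕ) : ℤ))).toContRepresentation
            (W₀.torsionGaloisModule (((3 : ℕ) : ℤ) ^ k * ((3 : ℕ) : ℤ))).toContRepresentation),
          Dk.IsCanonicalTauDatumThreeAtWith W₀ k k η → Dk'.IsCanonicalTauDatumThreeAtWith W₀ k' k' η → k ≤ k' →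
          (∀ x : W₀.geomTorsion (((3 : ℕ) : ℤ) ^ k' * ((3 : ℕ) : ℤ)),
            ((red x : W₀.geomTorsion (((3 : ℕ) : ℤ) ^ k * ((3 : ℕ) : ℤ))) : W₀.geomPoints) =
              (((3 : ℕ) : ℤ) ^ (k' - k)) • (x : W₀.geomPoints)) →
          ∃ κ Λ κ' κu Λu κu',
            Summit.BirchSwinnertonDyer.Rank1Residual.GaloisImage.KatoKuriharaWitnessAt W₀ k 0 Dk v₃ P κ Λ κ' ∧
            Summit.BirchSwinnertonDyer.Rank1Residual.GaloisImage.KatoKuriharaWitnessAt W₀ k' 0 Dk' v₃ P κu Λu κu' ∧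
            ∀ d, Dk'.IsLevel d → Dk.IsLevel d →
              Literature.NumberTheory.GaloisRepresentations.galoisCohomology.map red 1 (κu d) = κ d ∧
              Literature.NumberTheory.GaloisRepresentations.galoisCohomology.map red 1 (κu' d) = κ' d)

include hAll

/-- **Crux 19560 `KatoKuriharaPortThreeShared` (PORT″) BY NAME ⟸ the PORT@3-ALL item text**: PORT″ is the same
two-depth dictionary LOCKED behind antecedents (`Addv`, `3 ∤ c₃`, surj(3), `#E(ℚ₃)[3] = 3^0`, `v₃ ∣ 3`,
`3 ∤ c_P`, the period transfer) that the unlocked item simply does not need; the With-guards `(k + 0) k` and `k k`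
agree definitionally. [cite: Kim2022StructureSelmer, Thm. 3.13 (arXiv p. 17)] [cite: Kato2004Asterisque, Thm. 12.5 (1)]
[cite: MazurRubin2004, Thm. 3.2.4 and App. A (33)] -/
theorem katoKuriharaPortThreeShared_of_portAll : KatoKuriharaPortThreeShared := by
  intro W _ _ htow _ _ ht v₃ hv₃ η hη N _ P hN hopt _ k k' D D' red hD hD' hk hred _ _ _ _ _ _ _
  exact hAll W htow ht v₃ hv₃ η hη P hN hopt k k' D D' red hD hD' hk hred

/-- **PORT@3-ALL ⟹ PORT@3-OFF** (forget the stratum antecedent), in PortSeam's currency.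
[cite: Kim2022StructureSelmer, Thm. 3.13 (arXiv p. 17)] -/
theorem portOff_of_portAll :
    ∀ (W₀ : WeierstrassCurve ℚ) [W₀.IsElliptic] [W₀.IsGloballyMinimal],
      (∀ n : ℕ, W₀.HasSurjectiveModNGaloisRep (3 ^ n : ℕ)) →
      Nat.card {Q : (W₀.baseChange ℚ_[3]).toAffine.Point // (3 : ℕ) • Q = 0} = 1 →
      ∀ (v₃ : HeightOneSpectrum (𝓞 ℚ)), ((3 : ℕ) : 𝓞 ℚ) ∈ v₃.asIdeal →
      ∀ (η : (q : HeightOneSpectrum (𝓞 ℚ)) → (ZMod (Ideal.absNorm q.asIdeal))ˣ),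
        (∀ q, Subgroup.zpowers (η q) = ⊤) →
      ∀ {N : ℕ} [NeZero N] (P : ModularParametrizationData W₀ N), N = W₀.conductorNorm ℤ →
        (∀ z ∈ P.L.lattice, ∃ w ∈ periodLattice P.f, z = P.c * w) →
        ¬ ((haveI : Fact (Nat.Prime 3) := ⟨Nat.prime_three⟩; Addv W₀ 3) ∧
            ¬ 3 ∣ (W₀.baseChange ℚ_[3]).localTamagawaNumber ℤ_[3] ∧ ¬ (3 : ℤ) ∣ P.maninConstant) →
        ∃ e : ℕ, ∀ (k k' : ℕ)
          (Dk : KolyvaginDatum (W₀.torsionGaloisModule (((3 : ℕ) : ℤ) ^ k * ((3 : ℕ) : ℤ))))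
          (Dk' : KolyvaginDatum (W₀.torsionGaloisModule (((3 : ℕ) : ℤ) ^ k' * ((3 : ℕ) : ℤ))))
          (red : (W₀.torsionGaloisModule (((3 : ℕ) : ℤ) ^ k' * ((3 : ℕ) : ℤ))).toContRepresentation →ⁱL
            (W₀.torsionGaloisModule (((3 : ℕ) : ℤ) ^ k * ((3 : ℕ) : ℤ))).toContRepresentation),
          Dk.IsCanonicalTauDatumThreeAtWith W₀ k k η → Dk'.IsCanonicalTauDatumThreeAtWith W₀ k' k' η → k ≤ k' →
          (∀ x : geomTorsion W₀ (((3 : ℕ) : ℤ) ^ k' * ((3 : ℕ) : ℤ)),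
            ((red x : geomTorsion W₀ (((3 : ℕ) : ℤ) ^ k * ((3 : ℕ) : ℤ))) : geomPoints W₀) =
              (((3 : ℕ) : ℤ) ^ (k' - k)) • (x : geomPoints W₀)) →
          ∃ κ Λ κ' κu Λu κu',
            KatoKuriharaWitnessAtTwoExp W₀ k 0 e Dk v₃ P κ Λ κ' ∧
            KatoKuriharaWitnessAtTwoExp W₀ k' 0 e Dk' v₃ P κu Λu κu' ∧
            ∀ d, Dk'.IsLevel d → Dk.IsLevel d →
              galoisCohomology.map red 1 (κu d) = κ d ∧ galoisCohomology.map red 1 (κu' d) = κ' d :=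
  portOff_of_portOffWitnessAt fun W₀ _ _ htow ht v₃ hv₃ η hη _ _ P hN hopt _ =>
    hAll W₀ htow ht v₃ hv₃ η hη P hN hopt

/-- **Alias 19678 `KatoStratumSharedParts` BY NAME ⟸ its four PUBLISHED leaves ∧ the PORT@3-ALL item text.**
[cite: Sakamoto2024, Thm. 4.4 (p. 926)] [cite: Carayol1986] [cite: MilneADT2006, Ch. I, Thm. 4.10] -/
theorem katoStratumSharedParts_of_pub_of_portAll (hSak : SakamotoKolyvaginThree)
    (hGZK : RankEqAnalyticRankLeOne) (hPT : PoitouTateSelmerDuality) (hlev : CarayolLevelEqConductor) :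
    KatoStratumSharedParts :=
  ⟨hSak, hGZK, hPT, hlev, katoKuriharaPortThreeShared_of_portAll hAll⟩

/-- **THE ROUTE'S LEAF `N11.KimAtThreeRankZeroPUB` ⟸ the four PUBLISHED leaves (Sakamoto 2024 Thm. 4.4 (1)(2),
Gross–Zagier–Kolyvagin, Poitou–Tate, Carayol) ∧ the PORT@3-ALL item text**: W2 = PUB + ONE displayed Kato–Kurihara
port at `3` (Kim AJM 148 Thm. 3.13 at `p = 3` in unlocked two-depth form on the `E(ℚ₃)[3] = 0` tower rows; FLAG
`K22-Thm3.13-PORT@3`). [cite: Kim2025RefinedTNC, Thm. 1.1] [cite: Kim2022StructureSelmer, Thm. 1.9 (6) and Thm. 3.13]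
[cite: Sakamoto2024, Thm. 4.4 (p. 926)] [cite: MazurRubin2004, Thm. 4.4.1 and Thm. 5.2.12] [cite: Carayol1986] -/
theorem kimAtThreeRankZeroPUB_of_pub_of_portAll (hSak : SakamotoKolyvaginThree)
    (hGZK : RankEqAnalyticRankLeOne) (hPT : PoitouTateSelmerDuality) (hlev : CarayolLevelEqConductor) :
    N11.KimAtThreeRankZeroPUB :=
  kimAtThreeRankZeroPUB_of_sharedParts_of_portOff (portOff_of_portAll hAll)
    (katoStratumSharedParts_of_pub_of_portAll hAll hSak hGZK hPT hlev)

/-- **Crux 19077 `ShallowEqDeepAtTorsionFree` BY NAME ⟸ the four PUBLISHED leaves ∧ the PORT@3-ALL item text.**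
[cite: Kim2025RefinedTNC, Thm. 1.1 and Thm. 1.2] [cite: Sakamoto2024, Thm. 4.4 (p. 926)] -/
theorem shallowEqDeepAtTorsionFree_of_pub_of_portAll (hSak : SakamotoKolyvaginThree)
    (hGZK : RankEqAnalyticRankLeOne) (hPT : PoitouTateSelmerDuality) (hlev : CarayolLevelEqConductor) :
    ShallowEqDeepAtTorsionFree :=
  shallowEqDeepAtTorsionFree_of_sharedParts_of_portOff (portOff_of_portAll hAll)
    (katoStratumSharedParts_of_pub_of_portAll hAll hSak hGZK hPT hlev)

end All

end Summit.BirchSwinnertonDyer.BirchSwinnertonDyer.Theorems.KimAtThreeShallowEqDeepPortItem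

end
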